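import Literature.Analysis.FluidPDE.ExtremeGrowthBounds
import Literature.Analysis.FluidPDE.TorusNSSmoothLocalExistence
import Literature.Analysis.FunctionSpaces.TorusClassicalNSGluing
import Literature.Analysis.FunctionSpaces.TorusConvolution
import Literature.Analysis.FunctionSpaces.TorusInverseLaplacianCalculus
import HarnessLib
import HarnessLib.Audit

/-!
# Functional mining for 3D Navier–Stokes: rate budgets (template, positive control, two sieves)

Search for candidate a priori estimates; no regularity claim.

Cell `pub-nsfunc` (NS functional mining; host summit NavierStokesRegularity, topic
`FunctionalMining`) tests, along an adversarial bank of trajectories, candidate inequalities of the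
shape `dF/dt ≤ C · G` for integral functionals `F` of smooth solutions of the incompressible
Navier–Stokes equations, `G` a controlled quantity. This file fixes the FORMAL counterpart of a
census row in the tree's own setting for periodic classical solutions (the DNS setting): the unit
3-torus, zero-mean classical solutions of the unforced system on a time window `[a, b]`
(`Torus.IsClassicalNSSolutionOn (Icc a b) ν 0 u p`, `FunctionSpaces/TorusFluidGlue`), one-sided
time derivatives within `[a, b]` — exactly the shape of the tree's named fact
`LuDoering2008_enstrophyRate_le` (`dℰ/dt ≤ 27/(8π⁴ν³) ℰ³`, `FluidPDE/ExtremeGrowthBounds`).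

* `IsRateBudget F B` — "along every zero-mean classical solution, `t ↦ F(u(t))` is
  differentiable within `[a, b]` and `d/dt F(u(t)) ≤ B ν (u t)`". Differentiability is PART of
  the predicate, so it is never vacuously true for a non-differentiable `F`.
* `IsRateBudget.mono`; `isRateBudget_torusEnstrophy_cubic_iff` — the Lu–Doering fact is literally
  the budget `B = C_LD(ν) ℰ³` (the enstrophy is differentiable along classical solutions by the
  tree's `H¹` balance `Torus.IsClassicalNSSolutionOn.hasDerivWithinAt_half_gradNormSq`);
* `kineticEnergy_isRateBudget` — POSITIVE CONTROL: `dK/dt = −ν‖∇u‖₂² ≤ 0` (from the tree's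
  discharged energy balance), hence `kineticEnergy_isRateBudget_zero` (energy is non-increasing);
* `EnstrophyQuadraticBudget C` — the census row "`dℰ/dt ≤ (C/ν) ℰ²`" (the Grönwall-closable
  degree: `∫ℰ dt ≤ K(a)/(2ν)`), filed as a NAMED CANDIDATE, expected FALSE by the scaling sieve
  below (it is the formal target of the cell's no-go branch; nothing is asserted about it here);
* the two SIEVES (space-time scaling; amplitude + time-reversal parity) that decide whole classes
  of census rows without computation are the companion file `FunctionalMining/Sieves.lean`;
* (appended) `IsSupBudget F Φ` — the integrated template `F(u(t)) ≤ Φ ν (u a)`;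
  `IsRateBudget.isSupBudget_self` (rate `≤ 0` ⇒ bounded by the initial value),
  `kineticEnergy_isSupBudget_self`; `EnstrophyThreeHalvesLaw C` — census row C2, the
  Kang–Yun–Protas `3/2`-law in dimensionless form (named candidate, nothing asserted);
* (appended, §"dynamic reduction") `HasInitialRate`, `initialRate_le_of_isRateBudget`,
  `inertialRate_nonpos_of_nonincreasing`, `inertialRate_eq_zero_of_nonincreasing` — the dynamic
  reduction behind the sieves, proved from the tree's local existence on `T³`; enstrophy instance
  `enstrophyProduction_eq_zero_of_enstrophy_nonincreasing`,
  `not_isRateBudget_torusEnstrophy_zero_of_witness` (cell files cannot import one another under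
  the current gate lint, hence appended here rather than filed as `InertialRate.lean`).

Deliberately NOT here: any claim that a candidate holds; whole-space versions; the witness data
that refute `EnstrophyQuadraticBudget` (no-go branch); time-integrated and threshold
(invariant-region) templates.
-/

noncomputable section

open MeasureTheory Set Filter
open scoped Topology InnerProductSpace RealInnerProductSpace

namespace Summit.NavierStokesRegularity.FunctionalMining

open Literature.Analysis.FunctionSpaces Literature.Analysis.FluidPDE

variable {d : Type*} [Fintype d] [DecidableEq d]

/-! ## The template -/

/-- **Rate budget along Navier–Stokes (census template).** For a functional `F` of velocity
fields on the unit torus and a budget `B ν v`: on the 3-torus (`Fintype.card d = 3`), for every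
viscosity `ν > 0`, every window `a < b`, every classical solution `(u, p)` of the UNFORCED
Navier–Stokes system on `T³ × [a, b]` with zero spatial mean at all times, and every `t ∈ [a, b]`,
the function `s ↦ F (u s)` is differentiable within `[a, b]` at `t` and its one-sided derivative
satisfies `d/dt F(u(t)) ≤ B ν (u t)`. This is the formal reading of a census row
"`dF/dt ≤ C·G` along every trajectory" of the functional-mining cell; a candidate is such a
statement with `B` a controlled quantity. Search for candidate a priori estimates; no regularity
claim: instances are named `def`s, never asserted. -/
def IsRateBudget (F : (UnitAddTorus d → EuclideanSpace ℝ d) → ℝ)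
    (B : ℝ → (UnitAddTorus d → EuclideanSpace ℝ d) → ℝ) : Prop :=
  Fintype.card d = 3 → ∀ ⦃ν : ℝ⦄, 0 < ν → ∀ ⦃a b : ℝ⦄, a < b →
    ∀ ⦃u : ℝ → UnitAddTorus d → EuclideanSpace ℝ d⦄ ⦃p : ℝ → UnitAddTorus d → ℝ⦄,
      Torus.IsClassicalNSSolutionOn (Icc a b) ν 0 u p →
      (∀ t ∈ Icc a b, Torus.HasZeroMean (u t)) →
      ∀ t ∈ Icc a b,
        DifferentiableWithinAt ℝ (fun s => F (u s)) (Icc a b) t ∧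
          derivWithin (fun s => F (u s)) (Icc a b) t ≤ B ν (u t)

/-- A budget may be weakened pointwise: if `B ≤ B'` on fields (for `ν > 0`) then a budget `B`
for `F` is a budget `B'` for `F`. [folklore] -/
theorem IsRateBudget.mono {F : (UnitAddTorus d → EuclideanSpace ℝ d) → ℝ}
    {B B' : ℝ → (UnitAddTorus d → EuclideanSpace ℝ d) → ℝ}
    (h : IsRateBudget F B) (hBB' : ∀ ν, 0 < ν → ∀ v, B ν v ≤ B' ν v) : IsRateBudget F B' := by
  intro hd ν hν a b hab u p hsol hmean t ht
  obtain ⟨hdiff, hle⟩ := h hd hν hab hsol hmean t ht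
  exact ⟨hdiff, hle.trans (hBB' ν hν (u t))⟩

/-- In the differentiable regime the template is the "every one-sided derivative value" form used
by the tree's named facts: if `s ↦ F(u s)` has derivative `R` within `[a, b]` at `t` (`a < b`)
then `R` is `derivWithin`, so `R ≤ B` follows from the budget. [folklore] -/
theorem IsRateBudget.le_of_hasDerivWithinAt {F : (UnitAddTorus d → EuclideanSpace ℝ d) → ℝ}
    {B : ℝ → (UnitAddTorus d → EuclideanSpace ℝ d) → ℝ} (h : IsRateBudget F B)
    (hd : Fintype.card d = 3) {ν a b : ℝ} (hν : 0 < ν) (hab : a < b)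
    {u : ℝ → UnitAddTorus d → EuclideanSpace ℝ d} {p : ℝ → UnitAddTorus d → ℝ}
    (hsol : Torus.IsClassicalNSSolutionOn (Icc a b) ν 0 u p)
    (hmean : ∀ t ∈ Icc a b, Torus.HasZeroMean (u t)) {t : ℝ} (ht : t ∈ Icc a b) {R : ℝ}
    (hR : HasDerivWithinAt (fun s => F (u s)) R (Icc a b) t) : R ≤ B ν (u t) := by
  obtain ⟨_, hle⟩ := h hd hν hab hsol hmean t ht
  rwa [hR.derivWithin (uniqueDiffOn_Icc hab t ht)] at hle

/-! ## The enstrophy: Lu–Doering's cubic law is a budget in this sense -/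

/-- **The Lu–Doering estimate is the cubic enstrophy budget.** The tree's named fact
`LuDoering2008_enstrophyRate_le` (`dℰ/dt ≤ 27/(8π⁴ν³) ℰ³`, Lu–Doering 2008; Ayala–Protas 2017
eq. (2.7)) is equivalent to `IsRateBudget ℰ (ν, v ↦ C_LD(ν) ℰ(v)³)`; the differentiability
clause holds along classical solutions by the `H¹` balance
`Torus.IsClassicalNSSolutionOn.hasDerivWithinAt_half_gradNormSq`. Nothing is asserted about the
fact itself. [folklore] -/
theorem isRateBudget_torusEnstrophy_cubic_iff :
    IsRateBudget (d := d) torusEnstrophy (fun ν v => luDoeringConst ν * torusEnstrophy v ^ 3) ↔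
      LuDoering2008_enstrophyRate_le (d := d) := by
  constructor
  · intro h hd ν hν a b hab u p hsol hmean t ht R hR
    exact h.le_of_hasDerivWithinAt hd hν hab hsol hmean ht hR
  · intro h hd ν hν a b hab u p hsol hmean t ht
    have hder : HasDerivWithinAt (fun s => torusEnstrophy (u s))
        (-ν * (∫ x, ‖Torus.laplacian (u t) x‖ ^ 2) +
          ∫ x, ⟪Torus.convect (u t) (u t) x - (0 : ℝ → UnitAddTorus d → EuclideanSpace ℝ d) t x,
            Torus.laplacian (u t) x⟫) (Icc a b) t :=
      hsol.hasDerivWithinAt_half_gradNormSq hab ht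
    refine ⟨hder.differentiableWithinAt, ?_⟩
    rw [hder.derivWithin (uniqueDiffOn_Icc hab t ht)]
    exact h hd hν hab hsol hmean t ht _ hder

/-! ## Positive control: the kinetic energy -/

/-- **Positive control (energy).** Along every zero-mean classical solution of unforced
Navier–Stokes on `T³ × [a, b]` the kinetic energy `K = ½∫|u|²` is differentiable within `[a, b]`
with `dK/dt = −ν‖∇u‖₂²`; in particular `K` obeys the budget `B = −ν‖∇u‖₂²` (with equality).
From the tree's discharged energy balance `Torus.IsClassicalNSSolutionOn.energy_balance_holds`
(Doering–Foias 2002, eq. (2.4)). The census must reproduce this row with zero violations.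
[folklore] -/
theorem kineticEnergy_isRateBudget :
    IsRateBudget (d := d) Torus.kineticEnergy (fun ν v => -(ν * Torus.gradNormSq v)) := by
  intro hd ν hν a b hab u p hsol hmean t ht
  have hE := Torus.IsClassicalNSSolutionOn.energy_balance_holds hsol (convex_Icc a b) ht
  have hzero : (∫ x, ⟪(0 : ℝ → UnitAddTorus d → EuclideanSpace ℝ d) t x, u t x⟫) = 0 := by
    simp
  rw [hzero, add_zero] at hE
  refine ⟨hE.differentiableWithinAt, ?_⟩
  rw [hE.derivWithin (uniqueDiffOn_Icc hab t ht)]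
  exact le_of_eq (neg_mul ν _)

/-- **Energy is non-increasing** along every zero-mean classical solution of unforced
Navier–Stokes on the 3-torus: the budget `B = 0` for `K` (`−ν‖∇u‖₂² ≤ 0`). The only survivor of
the parity–amplitude sieve among even homogeneous functionals is of this kind (a formal Euler
invariant dissipated by the Stokes direction). [folklore] -/
theorem kineticEnergy_isRateBudget_zero :
    IsRateBudget (d := d) Torus.kineticEnergy (fun _ _ => 0) :=
  kineticEnergy_isRateBudget.mono fun ν hν v => by
    have := Torus.gradNormSq_nonneg v
    nlinarith

/-! ## A named candidate (census row C1; no-go target) -/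

/-- **Candidate C1: quadratic (Grönwall-closable) enstrophy budget with constant `C`.** The
statement "`dℰ/dt ≤ (C/ν) ℰ²` along every zero-mean classical solution of unforced Navier–Stokes
on `T³`", `ℰ = ½‖∇u‖₂²` (`torusEnstrophy`). Since `∫ₐᵇ ℰ dt ≤ K(u(a))/(2ν)` (energy balance),
such a budget would propagate `ℰ` by Grönwall; its degree under the Navier–Stokes scaling is
`s = 2`, one unit below the degree `3 = s_ℰ + 2` that the space-time scaling sieve forces on any
universal budget (`exponent_le_of_forall_nat_mul_rpow_le`), so it is EXPECTED FALSE (witness: a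
concentrating divergence-free bump with positive enstrophy production; Lu–Doering 2008 maximisers
realise `dℰ/dt ∼ ℰ³`). Filed as the formal target of the cell's no-go branch and as census row
C1 (calibration: the census must see violations on extreme-growth data). Search for candidate a
priori estimates; no regularity claim — nothing is asserted. -/
@[conjecture] def EnstrophyQuadraticBudget (C : ℝ) : Prop :=
  IsRateBudget (d := d) torusEnstrophy (fun ν v => C / ν * torusEnstrophy v ^ 2)

/-! ## Integrated (sup-type) budgets — appended 2026-08-19 (census "finite-time growth" rows)

Search for candidate a priori estimates; no regularity claim. The census also tests TIME-INTEGRATED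
candidates `F(u(t)) ≤ Φ(ν, u(a))` for `t ≥ a` (implementation B of METHODS: finite differences of
`F` across stored frames); the extreme-growth literature states its only empirical law in this form
(Kang–Yun–Protas 2020, §5 eq. (5.1): `max_t ℰ ≈ 0.224 ℰ₀^{1.49}` on the unit torus at `ν = 0.01`;
tree `enstrophyMajorant C E Z = C·Z·(1 + √(E Z))`, `FluidPDE/EnstrophyBudgetContinuity`). -/

/-- **Sup budget along Navier–Stokes (census template, integrated form).** For a functional `F` and a
majorant `Φ ν v₀` depending on the viscosity and the INITIAL field of the window: on the 3-torus,
for every `ν > 0`, `a < b`, every zero-mean classical solution `(u, p)` of unforced Navier–Stokes on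
`T³ × [a, b]` and every `t ∈ [a, b]`, `F (u t) ≤ Φ ν (u a)`. No differentiability is involved. -/
def IsSupBudget (F : (UnitAddTorus d → EuclideanSpace ℝ d) → ℝ)
    (Φ : ℝ → (UnitAddTorus d → EuclideanSpace ℝ d) → ℝ) : Prop :=
  Fintype.card d = 3 → ∀ ⦃ν : ℝ⦄, 0 < ν → ∀ ⦃a b : ℝ⦄, a < b →
    ∀ ⦃u : ℝ → UnitAddTorus d → EuclideanSpace ℝ d⦄ ⦃p : ℝ → UnitAddTorus d → ℝ⦄,
      Torus.IsClassicalNSSolutionOn (Icc a b) ν 0 u p →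
      (∀ t ∈ Icc a b, Torus.HasZeroMean (u t)) →
      ∀ t ∈ Icc a b, F (u t) ≤ Φ ν (u a)

/-- A sup budget may be weakened pointwise. [folklore] -/
theorem IsSupBudget.mono {F : (UnitAddTorus d → EuclideanSpace ℝ d) → ℝ}
    {Φ Φ' : ℝ → (UnitAddTorus d → EuclideanSpace ℝ d) → ℝ}
    (h : IsSupBudget F Φ) (hΦ : ∀ ν, 0 < ν → ∀ v, Φ ν v ≤ Φ' ν v) : IsSupBudget F Φ' :=
  fun hd ν hν a _ hab u _ hsol hmean t ht => (h hd hν hab hsol hmean t ht).trans (hΦ ν hν (u a))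

/-- **A non-increasing functional is bounded by its initial value**: the zero rate budget implies the
sup budget `Φ ν v₀ = F v₀`. (The rate template carries differentiability within `[a, b]` at every
point, hence continuity on `[a, b]`; a function with non-positive one-sided derivative on an
interval is antitone.) [folklore] -/
theorem IsRateBudget.isSupBudget_self {F : (UnitAddTorus d → EuclideanSpace ℝ d) → ℝ}
    (h : IsRateBudget F (fun _ _ => 0)) : IsSupBudget F (fun _ v => F v) := by
  intro hd ν hν a b hab u p hsol hmean t ht
  set f : ℝ → ℝ := fun s => F (u s) with hf
  have hdiff : ∀ s ∈ Icc a b, DifferentiableWithinAt ℝ f (Icc a b) s :=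
    fun s hs => (h hd hν hab hsol hmean s hs).1
  have hder : ∀ s ∈ Icc a b, HasDerivWithinAt f (derivWithin f (Icc a b) s) (Icc a b) s :=
    fun s hs => (hdiff s hs).hasDerivWithinAt
  have hle : ∀ s ∈ Icc a b, derivWithin f (Icc a b) s ≤ 0 :=
    fun s hs => (h hd hν hab hsol hmean s hs).2
  have hanti : AntitoneOn f (Icc a b) := by
    refine antitoneOn_of_hasDerivWithinAt_nonpos (convex_Icc a b)
      (fun s hs => (hder s hs).continuousWithinAt)
      (fun s hs => (hder s (interior_subset hs)).mono interior_subset) fun s hs => ?_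
    exact hle s (interior_subset hs)
  exact hanti (left_mem_Icc.2 hab.le) ht ht.1

/-- **Positive control (energy, integrated form):** `K(u(t)) ≤ K(u(a))` for `a ≤ t ≤ b` along every
zero-mean classical solution of unforced Navier–Stokes on `T³ × [a, b]`. [folklore] -/
theorem kineticEnergy_isSupBudget_self :
    IsSupBudget (d := d) Torus.kineticEnergy (fun _ v => Torus.kineticEnergy v) :=
  kineticEnergy_isRateBudget_zero.isSupBudget_self

/-- **Candidate C2: the `3/2`-law for finite-time enstrophy growth (dimensionally consistent form).**
The statement "`ℰ(u(t)) ≤ C · ℰ(u(a)) · (1 + √(K(u(a)) ℰ(u(a))) / ν²)` for all `a ≤ t ≤ b` along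
every zero-mean classical solution of unforced Navier–Stokes on `T³ × [a, b]`", with
`ℰ = torusEnstrophy = ½‖∇u‖₂²`, `K = Torus.kineticEnergy = ½‖u‖₂²`; `K ℰ/ν⁴` is the
scale-invariant (and dimensionless) size of the datum, so the right side is
`enstrophyMajorant C (K/ν⁴) ℰ` of `FluidPDE/EnstrophyBudgetContinuity`. Origin: the only published
law for finite-time growth is EMPIRICAL, `max_t ℰ ≈ 0.224 ℰ₀^{1.49}` over optimal data with
`ℰ₀ ∈ [100, 1000]`, unit torus, `ν = 0.01` (Kang–Yun–Protas 2020, §5 eq. (5.1)); in the small-data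
region `27 K ℰ < (2πν)⁴` a bound of this shape follows from the Lu–Doering estimate
(`torusEnstrophy_le_of_small`). A sup budget of this kind would bound `ℰ` on every window, i.e. it
is a quantitative global-regularity statement for periodic data: OPEN, consistent with both
sieves (it is not an instantaneous monomial budget; amplitude degree 4 ≥ 3), refutable by one
trajectory (census row C2: the bank's first adversarial target is `max ℰ/ℰ₀^{3/2}`). Search for
candidate a priori estimates; no regularity claim — nothing is asserted. -/
@[conjecture] def EnstrophyThreeHalvesLaw (C : ℝ) : Prop :=
  IsSupBudget (d := d) torusEnstrophy (fun ν v =>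
    C * torusEnstrophy v * (1 + Real.sqrt (Torus.kineticEnergy v * torusEnstrophy v) / ν ^ 2))

/-! ## Dynamic reduction: initial rates at data (appended 2026-08-19)

Search for candidate a priori estimates; no regularity claim. A rate budget along EVERY solution
restricts the initial rate at EVERY smooth divergence-free zero-mean datum; with `ν → 0⁺` and the
parity `u ↦ −u` this is the dynamic input of the parity sieve (`Sieves.lean`), run here for `ℰ`:
one field with non-zero production (no-go branch; e.g. the three-wave field of
`FluidComputer/EnstrophyProduction`, production `2` in Galerkin units) refutes monotonicity. -/

/-- **Initial-rate structure.** `F` has inertial rate `N` and viscous rate `V`: along every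
zero-mean classical solution of unforced Navier–Stokes (`ν > 0`) on `T³ × [a, b]`, `a < b`,
`s ↦ F (u s)` has one-sided derivative `N (u a) + ν * V (u a)` within `[a, b]` at `t = a`
(the balance identity of an integral functional at the initial time). -/
def HasInitialRate (F : (UnitAddTorus d → EuclideanSpace ℝ d) → ℝ)
    (N V : (UnitAddTorus d → EuclideanSpace ℝ d) → ℝ) : Prop :=
  Fintype.card d = 3 → ∀ ⦃ν : ℝ⦄, 0 < ν → ∀ ⦃a b : ℝ⦄, a < b →
    ∀ ⦃u : ℝ → UnitAddTorus d → EuclideanSpace ℝ d⦄ ⦃p : ℝ → UnitAddTorus d → ℝ⦄,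
      Torus.IsClassicalNSSolutionOn (Icc a b) ν 0 u p →
      (∀ t ∈ Icc a b, Torus.HasZeroMean (u t)) →
      HasDerivWithinAt (fun s => F (u s)) (N (u a) + ν * V (u a)) (Icc a b) a

/-- **Dynamic reduction.** A rate budget `B` along every solution and initial rates `(N, V)`
give `N u₀ + ν V u₀ ≤ B ν u₀` at every smooth divergence-free zero-mean datum `u₀` on `T³`,
`ν > 0`: solve from `u₀` on a short `[0, T]` (`Torus.exists_classicalNS_smooth`), the zero mean
persists, and the one-sided derivative at `t = 0` is unique. [folklore] -/
theorem initialRate_le_of_isRateBudget {F : (UnitAddTorus d → EuclideanSpace ℝ d) → ℝ}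
    {N V : (UnitAddTorus d → EuclideanSpace ℝ d) → ℝ}
    {B : ℝ → (UnitAddTorus d → EuclideanSpace ℝ d) → ℝ}
    (hB : IsRateBudget F B) (hNV : HasInitialRate F N V) (hd : Fintype.card d = 3)
    {ν : ℝ} (hν : 0 < ν) {u₀ : UnitAddTorus d → EuclideanSpace ℝ d} (hu₀ : Torus.IsSmooth u₀)
    (hdiv : Torus.IsDivFree u₀) (hmean : Torus.HasZeroMean u₀) :
    N u₀ + ν * V u₀ ≤ B ν u₀ := by
  obtain ⟨T, hT, v, p, hsol, hv0, -⟩ :=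
    Torus.exists_classicalNS_smooth (d := d) hd.le hν.le hu₀ hdiv
  have hmean' : ∀ t ∈ Icc 0 T, Torus.HasZeroMean (v t) := fun t ht =>
    hsol.hasZeroMean_of_hasZeroMean (convex_Icc 0 T) (left_mem_Icc.2 hT.le) ht (hv0 ▸ hmean)
  have h0 : (0 : ℝ) ∈ Icc 0 T := left_mem_Icc.2 hT.le
  have hder : HasDerivWithinAt (fun s => F (v s)) (N (v 0) + ν * V (v 0)) (Icc 0 T) 0 :=
    hNV hd hν hT hsol hmean'
  have hle := hB.le_of_hasDerivWithinAt hd hν hT hsol hmean' h0 hder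
  rwa [hv0] at hle

/-- **Monotone along every solution ⇒ non-positive inertial rate at every datum**
(`N u₀ + ν V u₀ ≤ 0` for every `ν > 0`; let `ν → 0⁺`). [folklore] -/
theorem inertialRate_nonpos_of_nonincreasing {F : (UnitAddTorus d → EuclideanSpace ℝ d) → ℝ}
    {N V : (UnitAddTorus d → EuclideanSpace ℝ d) → ℝ}
    (h0 : IsRateBudget F (fun _ _ => 0)) (hNV : HasInitialRate F N V) (hd : Fintype.card d = 3)
    {u₀ : UnitAddTorus d → EuclideanSpace ℝ d} (hu₀ : Torus.IsSmooth u₀)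
    (hdiv : Torus.IsDivFree u₀) (hmean : Torus.HasZeroMean u₀) : N u₀ ≤ 0 := by
  have hν : ∀ ν : ℝ, 0 < ν → N u₀ + ν * V u₀ ≤ 0 := fun ν hν =>
    initialRate_le_of_isRateBudget h0 hNV hd hν hu₀ hdiv hmean
  by_contra hN
  have hN' : 0 < N u₀ := not_le.mp hN
  set ν : ℝ := N u₀ / (2 * (|V u₀| + 1)) with hνdef
  have hνpos : 0 < ν := by positivity
  have h1 := hν ν hνpos
  have h2 : -(ν * |V u₀|) ≤ ν * V u₀ := by
    rw [← mul_neg]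
    exact mul_le_mul_of_nonneg_left (neg_abs_le _) hνpos.le
  have h3 : ν * |V u₀| < N u₀ := by
    rw [hνdef, div_mul_eq_mul_div, div_lt_iff₀ (by positivity)]
    nlinarith [abs_nonneg (V u₀)]
  linarith

/-- Incompressibility is preserved by `u ↦ −u`. [folklore] -/
theorem isDivFree_neg {u : UnitAddTorus d → EuclideanSpace ℝ d} (hu : Torus.IsDivFree u) :
    Torus.IsDivFree (-u) := by
  intro x
  have h : Torus.divergence (-u) x = -Torus.divergence u x := by
    simp only [Torus.divergence]
    rw [← Finset.sum_neg_distrib]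
    exact Finset.sum_congr rfl fun i _ => by
      simpa using Torus.partialDeriv_neg i (fun y => u y i) x
  rw [h, hu x, neg_zero]

omit [DecidableEq d] in
/-- Zero mean is preserved by `u ↦ −u`. [folklore] -/
theorem hasZeroMean_neg {u : UnitAddTorus d → EuclideanSpace ℝ d} (hu : Torus.HasZeroMean u) :
    Torus.HasZeroMean (-u) := by
  unfold Torus.HasZeroMean at hu ⊢
  simp [integral_neg, hu]

/-- **Parity: monotone even functional ⇒ vanishing inertial rate.** If moreover `N` is odd on
smooth fields (the case of every EVEN functional, the Euler nonlinearity being even), then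
`N u₀ = 0` at every smooth divergence-free zero-mean datum: a formal Euler invariant on the data
class. [folklore] -/
theorem inertialRate_eq_zero_of_nonincreasing {F : (UnitAddTorus d → EuclideanSpace ℝ d) → ℝ}
    {N V : (UnitAddTorus d → EuclideanSpace ℝ d) → ℝ}
    (h0 : IsRateBudget F (fun _ _ => 0)) (hNV : HasInitialRate F N V)
    (hodd : ∀ u : UnitAddTorus d → EuclideanSpace ℝ d, Torus.IsSmooth u → N (-u) = -N u)
    (hd : Fintype.card d = 3) {u₀ : UnitAddTorus d → EuclideanSpace ℝ d}
    (hu₀ : Torus.IsSmooth u₀) (hdiv : Torus.IsDivFree u₀) (hmean : Torus.HasZeroMean u₀) :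
    N u₀ = 0 := by
  have h1 := inertialRate_nonpos_of_nonincreasing h0 hNV hd hu₀ hdiv hmean
  have h2 := inertialRate_nonpos_of_nonincreasing h0 hNV hd hu₀.neg (isDivFree_neg hdiv)
    (hasZeroMean_neg hmean)
  rw [hodd u₀ hu₀] at h2
  linarith

/-! ## The enstrophy instance -/

/-- **Enstrophy production** `v ↦ ∫_{T^d} ⟪(v·∇)v, Δv⟫` (`= ∫ω·Sω = −4∫det S` for smooth
divergence-free `v` on `T³`: the inertial rate of `ℰ = ½‖∇v‖₂²`). Junk: Bochner integral, `0`
if not integrable. -/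
def enstrophyProduction (v : UnitAddTorus d → EuclideanSpace ℝ d) : ℝ :=
  ∫ x, ⟪Torus.convect v v x, Torus.laplacian v x⟫

/-- **The enstrophy has initial rates** `N = enstrophyProduction`, `V(v) = −∫‖Δv‖²` (the tree's
`H¹` balance `Torus.IsClassicalNSSolutionOn.hasDerivWithinAt_half_gradNormSq` at `t = a`). [folklore] -/
theorem torusEnstrophy_hasInitialRate :
    HasInitialRate (d := d) torusEnstrophy enstrophyProduction
      (fun v => -∫ x, ‖Torus.laplacian v x‖ ^ 2) := by
  intro hd ν hν a b hab u p hsol hmean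
  have h := hsol.hasDerivWithinAt_half_gradNormSq hab (left_mem_Icc.2 hab.le)
  refine h.congr_deriv ?_
  simp only [enstrophyProduction, Pi.zero_apply, sub_zero]
  ring

omit [DecidableEq d] in
/-- The enstrophy production is odd on smooth fields: `(−v·∇)(−v) = (v·∇)v` and `Δ(−v) = −Δv`.
[folklore] -/
theorem enstrophyProduction_neg {v : UnitAddTorus d → EuclideanSpace ℝ d} (hv : Torus.IsSmooth v) :
    enstrophyProduction (-v) = -enstrophyProduction v := by
  unfold enstrophyProduction
  rw [← integral_neg]
  refine integral_congr_ae (ae_of_all _ fun x => ?_)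
  dsimp only
  have hc : Torus.convect (-v) (-v) x = Torus.convect v v x := by
    simp only [Torus.convect, Torus.fderiv]
    have hl : Torus.liftAt (-v) x = -Torus.liftAt v x := by
      funext w; simp [Torus.liftAt]
    rw [hl, fderiv_neg]
    simp
  rw [hc, Torus.laplacian_neg_apply hv x, inner_neg_right]

/-- **Were the enstrophy non-increasing along every zero-mean classical solution on `T³`, its
production would vanish at every smooth divergence-free zero-mean field** — the dynamic instance
of the parity sieve (`Sieves.lean`) for `F = ℰ`. [folklore] -/
theorem enstrophyProduction_eq_zero_of_enstrophy_nonincreasing (hd : Fintype.card d = 3)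
    (h0 : IsRateBudget (d := d) torusEnstrophy (fun _ _ => 0))
    {u₀ : UnitAddTorus d → EuclideanSpace ℝ d} (hu₀ : Torus.IsSmooth u₀)
    (hdiv : Torus.IsDivFree u₀) (hmean : Torus.HasZeroMean u₀) : enstrophyProduction u₀ = 0 :=
  inertialRate_eq_zero_of_nonincreasing h0 torusEnstrophy_hasInitialRate
    (fun _ hv => enstrophyProduction_neg hv) hd hu₀ hdiv hmean

/-- **One witness refutes the monotonicity of the enstrophy**: any smooth divergence-free
zero-mean field on `T³` with non-zero production (the no-go branch supplies it). [folklore] -/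
theorem not_isRateBudget_torusEnstrophy_zero_of_witness (hd : Fintype.card d = 3)
    {w : UnitAddTorus d → EuclideanSpace ℝ d} (hw : Torus.IsSmooth w) (hdiv : Torus.IsDivFree w)
    (hmean : Torus.HasZeroMean w) (hne : enstrophyProduction w ≠ 0) :
    ¬ IsRateBudget (d := d) torusEnstrophy (fun _ _ => 0) := fun h0 =>
  hne (enstrophyProduction_eq_zero_of_enstrophy_nonincreasing hd h0 hw hdiv hmean)

end Summit.NavierStokesRegularity.FunctionalMining
end
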